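import Summits.KontsevichZagierPeriods.KontsevichZagierPeriods.Theses.TerasomaMultiplication
import Summits.KontsevichZagierPeriods.KontsevichZagierPeriods.Theorems.CompleteModGammaSector.Negative.LoadBearing
import Summits.KontsevichZagierPeriods.KontsevichZagierPeriods.Theorems.TerasomaMultiplicationCompleteModGammaSectorStubFuchsianTransport
import Summits.KontsevichZagierPeriods.KontsevichZagierPeriods.Theorems.TerasomaMultiplicationCompleteModGammaSectorStubTorsionFreeModGamma
import Literature.NumberTheory.Transcendental.KZRulesAssociator

/-!
# `CompleteModGammaSector` (stmt-KontsevichZagierPeriods-14233) — line `Sketch`: the REDUCTION, kernel-checked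

Sorry-free companion of the line lead's registered skeleton `Cruxes/CompleteModGammaSector/Lines/Sketch.lean`
(card wronskian-transport). With the two landed halves of the transport engine
(`stub_fuchsianTransport`, p87891; `stub_torsionFreeModGamma`, p88705) this file proves that the crux is
EQUIVALENT to the conjunction of the line's three open registered stubs, each written out verbatim
(no definition is introduced):

* seam 2 `PiCancellationModGamma` — `⟦[disc,1]⟧` is a non-zero-divisor modulo the Γ-ideal
  `JΓ = Ideal.span (toFormalPeriod '' gammaHodgePairs)` of the formal period ring `P`;
* seam 3 `SpectatorStability` — the Γ-subgroup `sector` absorbs spectator products `[σ]·(Γ-pair)`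
  (⟺ the ideal-preimage form `IdealGap`: `idealGap_of_spectator`, `spectatorStability_of_idealGap`);
* the residual `AnchoredTransportData` — every value-zero combination is the endpoint fibre of anchored
  order-two transport data with `π`-proportional Wronskian;

`completeModGammaSector_iff_seams_and_residual`. The forward direction (`…_of_crux` lemmas) shows that
NO open stub of the line is refutable short of `¬ KontsevichZagierPeriods`
(`CompleteModGammaSectorNegative.summit_false_of_not`); the backward direction is the composition of the
skeleton. Bookkeeping: `span_gammaHodgePairs_le_ker_evalP` (`JΓ ≤ ker evalP`),
`toFormalPeriod_mem_span_of_mem_sector` (`sector ↦ JΓ`), `mul_mem_sector_of_spectator`.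

References: Kontsevich–Zagier 2001 §1.2, §4.1; Andrews–Askey–Roy 1999 §3.2 (Wronskians of the
hypergeometric equation; Legendre/Elliott); Huber–Wüstholz 2022 App. A.
-/

noncomputable section

-- `Summit.KontsevichZagierPeriods.KontsevichZagierPeriods.…` is the tree's mandated layout (single-conjunct summit).
set_option linter.dupNamespace false

namespace Summit.KontsevichZagierPeriods.KontsevichZagierPeriods.CompleteModGammaSectorLine

open MeasureTheory Set
open Literature.NumberTheory.Transcendental
open Literature.NumberTheory.Transcendental.KZ
open Summit.KontsevichZagierPeriods.KontsevichZagierPeriods.Theses.TerasomaMultiplication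
  (CompleteModGammaSector)
open Summit.KontsevichZagierPeriods.CompleteModGammaSectorNegative
  (gammaHodgePairs sector completeModGammaSector_iff_ker_le closure_gammaHodgePairs_le_ker_eval
    sector_le_ker_eval)

/-! ## Seam 3: spectator stability ⟺ ideal gap -/

/-- If `sector` absorbs spectator products with Γ-pairs, then `sector` is a left ideal of
`FormalRep` (the `relations` summand is an ideal: `KZ.mul_mem_relations_left_holds`). [folklore] -/
theorem mul_mem_sector_of_spectator
    (H : ∀ (n : ℕ) (σ : IntegralRep n) (d : FormalRep), d ∈ gammaHodgePairs → of σ * d ∈ sector)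
    (b e : FormalRep) (he : e ∈ sector) : b * e ∈ sector := by
  have hgen : ∀ (b d : FormalRep), d ∈ gammaHodgePairs → b * d ∈ sector := by
    intro b d hd
    induction b using FreeAbelianGroup.induction_on with
    | zero => rw [zero_mul]; exact AddSubgroup.zero_mem _
    | of X => obtain ⟨n, σ⟩ := X; exact H n σ d hd
    | neg X ih => rw [neg_mul]; exact AddSubgroup.neg_mem _ ih
    | add X Y hX hY => rw [add_mul]; exact AddSubgroup.add_mem _ hX hY
  have he' : e ∈ relations ⊔ AddSubgroup.closure gammaHodgePairs := he
  obtain ⟨r, hr, g, hg, rfl⟩ := AddSubgroup.mem_sup.mp he'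
  rw [mul_add]
  refine AddSubgroup.add_mem _
    (AddSubgroup.mem_sup_left (mul_mem_relations_left_holds r b hr)) ?_
  refine AddSubgroup.closure_induction (p := fun g _ => b * g ∈ sector) ?_ ?_ ?_ ?_ hg
  · intro d hd; exact hgen b d hd
  · rw [mul_zero]; exact AddSubgroup.zero_mem _
  · intro x y _ _ hx hy; rw [mul_add]; exact AddSubgroup.add_mem _ hx hy
  · intro x _ hx; rw [mul_neg]; exact AddSubgroup.neg_mem _ hx

/-- Spectator stability implies the ideal-preimage form of the seam (`Submodule.span_induction`).
[folklore] -/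
theorem idealGap_of_spectator
    (H : ∀ (n : ℕ) (σ : IntegralRep n) (d : FormalRep), d ∈ gammaHodgePairs → of σ * d ∈ sector) :
    ∀ c : FormalRep, toFormalPeriod c ∈ Ideal.span (toFormalPeriod '' gammaHodgePairs) → c ∈ sector := by
  intro c hc
  suffices h : ∀ p ∈ Ideal.span (toFormalPeriod '' gammaHodgePairs), ∀ c : FormalRep,
      toFormalPeriod c = p → c ∈ sector from h _ hc c rfl
  intro p hp
  refine Submodule.span_induction (p := fun p _ => ∀ c : FormalRep, toFormalPeriod c = p → c ∈ sector)
    ?_ ?_ ?_ ?_ hp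
  · rintro _ ⟨d, hd, rfl⟩ c hcd
    have h1 : c - d ∈ sector := AddSubgroup.mem_sup_left (toFormalPeriod_eq_iff.mp hcd)
    have h2 : d ∈ sector := AddSubgroup.mem_sup_right (AddSubgroup.subset_closure hd)
    simpa using AddSubgroup.add_mem _ h1 h2
  · intro c hc0
    exact AddSubgroup.mem_sup_left (toFormalPeriod_eq_zero_iff.mp hc0)
  · intro x y _ _ hx hy c hcxy
    obtain ⟨a, rfl⟩ := toFormalPeriod_surjective x
    obtain ⟨b, rfl⟩ := toFormalPeriod_surjective y
    have ha := hx a rfl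
    have hb := hy b rfl
    rw [← map_add, toFormalPeriod_eq_iff] at hcxy
    have h3 : c - (a + b) ∈ sector := AddSubgroup.mem_sup_left hcxy
    simpa using AddSubgroup.add_mem _ h3 (AddSubgroup.add_mem _ ha hb)
  · intro a x _ hx c hcax
    obtain ⟨b, rfl⟩ := toFormalPeriod_surjective a
    obtain ⟨e, rfl⟩ := toFormalPeriod_surjective x
    have he := hx e rfl
    rw [smul_eq_mul, ← map_mul, toFormalPeriod_eq_iff] at hcax
    have h3 : c - b * e ∈ sector := AddSubgroup.mem_sup_left hcax
    simpa using AddSubgroup.add_mem _ h3 (mul_mem_sector_of_spectator H b e he)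

/-- Conversely the ideal-preimage form gives spectator stability (so the reshaped stub is EXACTLY
the old seam `IdealGap`). [folklore] -/
theorem spectatorStability_of_idealGap
    (h : ∀ c : FormalRep, toFormalPeriod c ∈ Ideal.span (toFormalPeriod '' gammaHodgePairs) → c ∈ sector) :
    ∀ (n : ℕ) (σ : IntegralRep n) (d : FormalRep), d ∈ gammaHodgePairs → of σ * d ∈ sector := by
  intro n σ d hd
  refine h _ ?_
  rw [map_mul]
  exact Ideal.mul_mem_left _ _ (Ideal.subset_span ⟨d, hd, rfl⟩)


/-! ## Bookkeeping: `JΓ ≤ ker evalP`, `sector ↦ JΓ`, and every open stub is crux-implied -/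

/-- The Γ-ideal lies in the kernel of evaluation (every Γ-pair has value `0`). [folklore] -/
theorem span_gammaHodgePairs_le_ker_evalP :
    Ideal.span (toFormalPeriod '' gammaHodgePairs) ≤ RingHom.ker evalP := by
  refine Ideal.span_le.mpr ?_
  rintro p ⟨d, hd, rfl⟩
  rw [SetLike.mem_coe, RingHom.mem_ker, evalP_toFormalPeriod]
  exact closure_gammaHodgePairs_le_ker_eval (AddSubgroup.subset_closure hd)

/-- The Γ-subgroup `sector` maps into the Γ-ideal of `P`. [folklore] -/
theorem toFormalPeriod_mem_span_of_mem_sector {c : FormalRep} (hc : c ∈ sector) :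
    toFormalPeriod c ∈ Ideal.span (toFormalPeriod '' gammaHodgePairs) := by
  have hle : sector ≤ ((Ideal.span (toFormalPeriod '' gammaHodgePairs)).toAddSubgroup).comap
      toFormalPeriod.toAddMonoidHom := by
    refine sup_le ?_ ((AddSubgroup.closure_le _).mpr ?_)
    · intro d hd
      rw [AddSubgroup.mem_comap]
      show toFormalPeriod d ∈ Ideal.span (toFormalPeriod '' gammaHodgePairs)
      rw [toFormalPeriod_eq_zero_of_mem hd]
      exact Submodule.zero_mem _
    · intro d hd
      rw [SetLike.mem_coe, AddSubgroup.mem_comap]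
      show toFormalPeriod d ∈ Ideal.span (toFormalPeriod '' gammaHodgePairs)
      exact Ideal.subset_span ⟨d, hd, rfl⟩
  have := hle hc
  rw [AddSubgroup.mem_comap] at this
  exact this

/-! ## Sorry-free bookkeeping: every open stub is crux-implied (no kill short of `¬` summit) -/

/-- Under the crux, every value-zero class lies in the Γ-ideal. [folklore] -/
theorem toFormalPeriod_mem_span_of_crux (h : CompleteModGammaSector) {c : FormalRep} (hc : eval c = 0) :
    toFormalPeriod c ∈ Ideal.span (toFormalPeriod '' gammaHodgePairs) :=
  toFormalPeriod_mem_span_of_mem_sector (completeModGammaSector_iff_ker_le.mp h hc)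

/-- Seam 2 is crux-implied. [folklore] -/
theorem piCancellationModGamma_of_crux (h : CompleteModGammaSector) :
    ∀ x : FormalPeriodRing, toFormalPeriod (of piRep) * x ∈ Ideal.span (toFormalPeriod '' gammaHodgePairs) →
      x ∈ Ideal.span (toFormalPeriod '' gammaHodgePairs) := by
  intro x hx
  obtain ⟨c, rfl⟩ := toFormalPeriod_surjective x
  refine toFormalPeriod_mem_span_of_crux h ?_
  have h0 : evalP (toFormalPeriod (of piRep) * toFormalPeriod c) = 0 := span_gammaHodgePairs_le_ker_evalP hx
  rw [map_mul, evalP_toFormalPeriod_of, piRep_value, evalP_toFormalPeriod, mul_eq_zero] at h0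
  exact h0.resolve_left Real.pi_ne_zero

/-- Seam 3 is crux-implied. [folklore] -/
theorem idealGap_of_crux (h : CompleteModGammaSector) :
    ∀ c : FormalRep, toFormalPeriod c ∈ Ideal.span (toFormalPeriod '' gammaHodgePairs) → c ∈ sector := by
  intro c hc
  refine completeModGammaSector_iff_ker_le.mp h ?_
  have h0 : evalP (toFormalPeriod c) = 0 := span_gammaHodgePairs_le_ker_evalP hc
  rwa [evalP_toFormalPeriod] at h0

/-- Seam 3 in generator form is crux-implied. [folklore] -/
theorem spectatorStability_of_crux (h : CompleteModGammaSector) :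
    ∀ (n : ℕ) (σ : IntegralRep n) (d : FormalRep), d ∈ gammaHodgePairs → of σ * d ∈ sector :=
  spectatorStability_of_idealGap (idealGap_of_crux h)

/-- The residual is crux-implied (degenerate constant family: anchor `⟦c⟧` itself, basis
`K = (⟦π⟧, 1)`). [folklore] -/
theorem anchoredTransportData_of_crux (h : CompleteModGammaSector) :
    ∀ c : FormalRep, eval c = 0 →
      ∃ (F₀ F₀' F₁' K₁₀ K₁₀' K₂₀ K₂₀' K₁₁ K₁₁' K₂₁ K₂₁' : FormalPeriodRing) (m a b p q : ℤ),
        m ≠ 0 ∧ q ≠ 0 ∧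
        F₀ ∈ Ideal.span (toFormalPeriod '' gammaHodgePairs) ∧
        F₀' ∈ Ideal.span (toFormalPeriod '' gammaHodgePairs) ∧
        m • (toFormalPeriod c * K₂₁' - F₁' * K₂₁) - a • (F₀ * K₂₀' - F₀' * K₂₀) = 0 ∧
        m • (toFormalPeriod c * K₁₁' - F₁' * K₁₁) - b • (F₀ * K₁₀' - F₀' * K₁₀) = 0 ∧
        p • (K₁₁ * K₂₁' - K₂₁ * K₁₁') - q • toFormalPeriod (of piRep) ∈
          Ideal.span (toFormalPeriod '' gammaHodgePairs) := by
  intro c hc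
  refine ⟨toFormalPeriod c, 0, 0, 1, 1, 1, 1, toFormalPeriod (of piRep), 1, 0, 1, 1, 1, 1, 1, 1,
    one_ne_zero, one_ne_zero, toFormalPeriod_mem_span_of_crux h hc, Submodule.zero_mem _, ?_, ?_, ?_⟩
  · simp
  · simp
  · simp


/-! ## The reduction -/

/-- **The line's reduction, kernel-checked**: the crux `CompleteModGammaSector` is EQUIVALENT to the
conjunction of the three open registered stubs of line `Sketch` — π-cancellation modulo the Γ-ideal,
spectator stability of the Γ-subgroup, and anchored transport data for every value-zero combination —
given the landed engine (`stub_fuchsianTransport`) and seam 1 (`stub_torsionFreeModGamma`).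
[cite: KontsevichZagier2001, §1.2 Conjecture 1] -/
theorem completeModGammaSector_iff_seams_and_residual :
    CompleteModGammaSector ↔
      ((∀ x : FormalPeriodRing, toFormalPeriod (of piRep) * x ∈ Ideal.span (toFormalPeriod '' gammaHodgePairs) →
          x ∈ Ideal.span (toFormalPeriod '' gammaHodgePairs)) ∧
       (∀ (n : ℕ) (σ : IntegralRep n) (d : FormalRep), d ∈ gammaHodgePairs → of σ * d ∈ sector) ∧
       (∀ c : FormalRep, eval c = 0 →
          ∃ (F₀ F₀' F₁' K₁₀ K₁₀' K₂₀ K₂₀' K₁₁ K₁₁' K₂₁ K₂₁' : FormalPeriodRing) (m a b p q : ℤ),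
            m ≠ 0 ∧ q ≠ 0 ∧
            F₀ ∈ Ideal.span (toFormalPeriod '' gammaHodgePairs) ∧
            F₀' ∈ Ideal.span (toFormalPeriod '' gammaHodgePairs) ∧
            m • (toFormalPeriod c * K₂₁' - F₁' * K₂₁) - a • (F₀ * K₂₀' - F₀' * K₂₀) = 0 ∧
            m • (toFormalPeriod c * K₁₁' - F₁' * K₁₁) - b • (F₀ * K₁₀' - F₀' * K₁₀) = 0 ∧
            p • (K₁₁ * K₂₁' - K₂₁ * K₁₁') - q • toFormalPeriod (of piRep) ∈
              Ideal.span (toFormalPeriod '' gammaHodgePairs))) := by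
  constructor
  · intro h
    exact ⟨piCancellationModGamma_of_crux h, spectatorStability_of_crux h, anchoredTransportData_of_crux h⟩
  · rintro ⟨hπ, hS, hA⟩
    refine completeModGammaSector_iff_ker_le.mpr fun c hc => ?_
    have hc0 : eval c = 0 := hc
    obtain ⟨F₀, F₀', F₁', K₁₀, K₁₀', K₂₀, K₂₀', K₁₁, K₁₁', K₂₁, K₂₁', m, a, b, p, q, hm, hq, hF₀,
      hF₀', h₁, h₂, hW⟩ := hA c hc0
    exact idealGap_of_spectator hS c (stub_fuchsianTransport F₀ F₀' (toFormalPeriod c) F₁' K₁₀ K₁₀'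
      K₂₀ K₂₀' K₁₁ K₁₁' K₂₁ K₂₁' m a b p q hπ stub_torsionFreeModGamma hm hq hF₀ hF₀' h₁ h₂ hW)

end Summit.KontsevichZagierPeriods.KontsevichZagierPeriods.CompleteModGammaSectorLine
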